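import Mathlib

/-!
# Route `KPlusLogSqLaw`, crux `TropicalB` (stmt-ValiantsHypothesis-19771) — the ODOMETER ALIGNMENT LAW:
# in every three-digit odometer chain the coarse digit couples to the two finer digits IN THE RATIO OF THEIR SLOPES

HONEST FRAMING.  Helper file (seat val-sym-trop-p1 g14, cell `pub-symmetroid`, 2026-08-28) toward the registered stubs
`stub_tropThin` / `stub_tropFat` of `Cruxes/TropicalB/Lines/birth.lean` (crux
`Summit.ValiantsHypothesis.ValiantsHypothesis.Theses.KPlusLogSqLaw.TropicalB`, item `stmt-ValiantsHypothesis-19771`, route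
`KPlusLogSqLaw`; `--supports … --as helper`).  Elementary real arithmetic about ABSTRACT Newton data (no matchings, no designs): it
constrains the VALUATIONS of any would-be «odometer» family of dominant terms (the route text's «why it might fail»), and bounds nothing
for `TropicalB` itself.  Nothing here bears on `TropicalB` in its window, `WeakLifting`, DoorA26/DoorA34, `MatrixDescartes`
(stmt-ValiantsHypothesis-18050) or VP ≠ VNP.  Companion memo: HOME/val-sym-trop-p1/g14/ODOMETER-ANATOMY-g14.md (§2(e)), where the law is
checked against exact Gordan certificates (it is necessary, not sufficient).

THE SETTING.  An odometer chain has dominant terms indexed by digits; take three digit levels `A ⊐ B ⊐ C` (coarse to fine) with slope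
weights `s_B, s_C > 0` (a `C`-step raises the slope by `s_C`; a `B`-CARRY — `B ↦ B+1`, `C : n_C − 1 ↦ 0` — raises it by
`g = s_B − (n_C − 1)·s_C > 0`), and valuations bilinear across digits plus arbitrary unary terms,
`V = q_AB·A·B + q_AC·A·C + q_BC·B·C + u_A(A) + u_B(B) + u_C(C)`.  Around a `B`-carry at coarse value `A = a` the three consecutive hull
slopes (last `C`-step, the carry, first `C`-step) are AFFINE IN `a`:
  `m₁(a) = (q_AC·a + X₁)/s_C`,   `m₂(a) = ((q_AB − (n_C−1)·q_AC)·a + X₂)/g`,   `m₃(a) = (q_AC·a + X₃)/s_C`,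
with `a`-free constants `X₁, X₂, X₃` collecting `q_BC`- and unary terms, and `X₃ − X₁ ≤ q_BC` because the unary increments of `C`
increase inside a run (strict convexity of the `C`-run).  Every state being a strict lower-hull vertex forces `m₁(a) < m₂(a) < m₃(a)` at
every coarse value `a`; using it at two values `a₀` and `a₀ + D` (`D ≥ 1` as soon as the coarse digit takes two values) gives

  **`D · |q_AB·s_C − q_AC·s_B| < q_BC · g`**   (`alignment_law`),

i.e. the coarse digit's couplings to `B` and to `C` stand in the ratio `s_B : s_C` of the finer slopes up to an error `< q_BC·g/(s_C·D)`:
a coarse digit couples to the fine CLOCK `s_B·B + s_C·C`, not to the fine digits separately.  Corollaries: with `q_AC = 0` the coupling to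
the middle digit is capped by the finest pair's coupling (`no_skipfree_coupling`); a large aligned coupling to `B` forces a nonzero coupling to
`C` (`coupling_AC_ne_zero_of_large`); and the two-digit form of the same bookkeeping: the coupling of a digit to the next coarser one must
exceed the spread of that digit's unary increments (`coupling_gt_spread`).  [folklore]-level arithmetic; the point is the statement (it kills
«link towers», adjacent-only couplings and any reader that counts coarse flips without their slope weights — memo §3).
-/

-- `Summit.ValiantsHypothesis.ValiantsHypothesis.…` repeats a component by the D-0017 layout; the name is mandated.
set_option linter.dupNamespace false
set_option autoImplicit false

namespace Summit.ValiantsHypothesis.ValiantsHypothesis.Theorems.KPlusLogSqLaw.OdometerAlignment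

/-- **ODOMETER ALIGNMENT LAW.**  Three digit levels `A ⊐ B ⊐ C`; `sC > 0` the slope of a `C`-step, `g > 0` the slope jump of a
`B`-carry, `g + nC1·sC` the slope weight of `B` (`nC1 = n_C − 1`); cross couplings `qAB, qAC, qBC`; `X₁, X₂, X₃` the `a`-free parts of
the three consecutive hull slopes around a `B`-carry (last `C`-step, carry, first `C`-step), with `X₃ − X₁ ≤ qBC` (convex `C`-run).
If the three slopes increase strictly both at coarse value `a₀` and at `a₀ + D` with `D > 0`, then
`D·|qAB·sC − qAC·(g + nC1·sC)| < qBC·g`. [folklore] -/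
theorem alignment_law {sC g nC1 qAB qAC qBC X₁ X₂ X₃ a₀ D : ℝ} (hsC : 0 < sC) (hg : 0 < g) (hD : 0 < D)
    (hX : X₃ - X₁ ≤ qBC)
    (h12 : (qAC * a₀ + X₁) / sC < ((qAB - nC1 * qAC) * a₀ + X₂) / g)
    (h23 : ((qAB - nC1 * qAC) * a₀ + X₂) / g < (qAC * a₀ + X₃) / sC)
    (h12' : (qAC * (a₀ + D) + X₁) / sC < ((qAB - nC1 * qAC) * (a₀ + D) + X₂) / g)
    (h23' : ((qAB - nC1 * qAC) * (a₀ + D) + X₂) / g < (qAC * (a₀ + D) + X₃) / sC) :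
    D * |qAB * sC - qAC * (g + nC1 * sC)| < qBC * g := by
  -- the rate difference `ρ` between the carry slope and the `C`-step slopes, as functions of `a`
  set ρ : ℝ := (qAB - nC1 * qAC) / g - qAC / sC with hρ
  have key : ρ * (g * sC) = qAB * sC - qAC * (g + nC1 * sC) := by
    rw [hρ]
    field_simp
    ring
  have e12 : (qAC * a₀ + X₁) / sC = qAC / sC * a₀ + X₁ / sC := by
    field_simp
  have e23 : ((qAB - nC1 * qAC) * a₀ + X₂) / g = (qAB - nC1 * qAC) / g * a₀ + X₂ / g := by
    field_simp
  have e3 : (qAC * a₀ + X₃) / sC = qAC / sC * a₀ + X₃ / sC := by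
    field_simp
  have e12' : (qAC * (a₀ + D) + X₁) / sC = qAC / sC * a₀ + X₁ / sC + qAC / sC * D := by
    field_simp
    ring
  have e23' : ((qAB - nC1 * qAC) * (a₀ + D) + X₂) / g
      = (qAB - nC1 * qAC) / g * a₀ + X₂ / g + (qAB - nC1 * qAC) / g * D := by
    field_simp
    ring
  have e3' : (qAC * (a₀ + D) + X₃) / sC = qAC / sC * a₀ + X₃ / sC + qAC / sC * D := by
    field_simp
    ring
  rw [e12, e23] at h12
  rw [e23, e3] at h23
  rw [e12', e23'] at h12'
  rw [e23', e3'] at h23'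
  have hgap : X₃ / sC - X₁ / sC ≤ qBC / sC := by
    rw [← sub_div]
    exact div_le_div_of_nonneg_right hX hsC.le
  -- the carry slope moves at rate `(qAB - nC1*qAC)/g`, its neighbours at rate `qAC/sC`; it must stay between them at `a₀` and `a₀ + D`
  have hlow : -(qBC / sC) < D * ρ := by
    have h1 : -(X₃ / sC - X₁ / sC) < D * ρ := by
      rw [hρ]
      nlinarith
    linarith
  have hupp : D * ρ < qBC / sC := by
    have h1 : D * ρ < X₃ / sC - X₁ / sC := by
      rw [hρ]
      nlinarith
    linarith
  have habs : |D * ρ| < qBC / sC := abs_lt.mpr ⟨hlow, hupp⟩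
  have hmul : |D * ρ| * (g * sC) < qBC / sC * (g * sC) := mul_lt_mul_of_pos_right habs (mul_pos hg hsC)
  have hr : qBC / sC * (g * sC) = qBC * g := by
    field_simp
  have hl : |D * ρ| * (g * sC) = D * |qAB * sC - qAC * (g + nC1 * sC)| := by
    rw [← key, abs_mul, abs_of_pos hD, abs_mul, abs_of_pos (mul_pos hg hsC)]
    ring
  rw [hr, hl] at hmul
  exact hmul

/-- **Corollary (no skip-free coupling).**  If the coarse digit does not couple to the finest one (`qAC = 0`), the law degenerates to
`D·|qAB|·sC < qBC·g`: the coupling to the middle digit is capped by the finest pair's coupling, whatever the unary terms — so a coarse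
digit of large range cannot sit on top of two multiplying digits through «adjacent pairs only». [folklore] -/
theorem no_skipfree_coupling {sC g nC1 qAB qBC X₁ X₂ X₃ a₀ D : ℝ} (hsC : 0 < sC) (hg : 0 < g) (hD : 0 < D)
    (hX : X₃ - X₁ ≤ qBC)
    (h12 : ((0 : ℝ) * a₀ + X₁) / sC < ((qAB - nC1 * 0) * a₀ + X₂) / g)
    (h23 : ((qAB - nC1 * 0) * a₀ + X₂) / g < ((0 : ℝ) * a₀ + X₃) / sC)
    (h12' : ((0 : ℝ) * (a₀ + D) + X₁) / sC < ((qAB - nC1 * 0) * (a₀ + D) + X₂) / g)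
    (h23' : ((qAB - nC1 * 0) * (a₀ + D) + X₂) / g < ((0 : ℝ) * (a₀ + D) + X₃) / sC) :
    D * |qAB| * sC < qBC * g := by
  have h := alignment_law (qAC := 0) hsC hg hD hX h12 h23 h12' h23'
  simp only [zero_mul, sub_zero] at h
  rw [abs_mul, abs_of_pos hsC, ← mul_assoc] at h
  exact h

/-- **Corollary (an aligned coupling to the middle digit forces a coupling to the finest digit).**  If `qBC·g ≤ D·qAB·sC` (a coupling
to `B` of the size the law allows only when aligned), then `qAC ≠ 0`. [folklore] -/
theorem coupling_AC_ne_zero_of_large {sC g nC1 qAB qAC qBC X₁ X₂ X₃ a₀ D : ℝ} (hsC : 0 < sC) (hg : 0 < g) (hD : 0 < D)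
    (hX : X₃ - X₁ ≤ qBC) (hbig : qBC * g ≤ D * qAB * sC)
    (h12 : (qAC * a₀ + X₁) / sC < ((qAB - nC1 * qAC) * a₀ + X₂) / g)
    (h23 : ((qAB - nC1 * qAC) * a₀ + X₂) / g < (qAC * a₀ + X₃) / sC)
    (h12' : (qAC * (a₀ + D) + X₁) / sC < ((qAB - nC1 * qAC) * (a₀ + D) + X₂) / g)
    (h23' : ((qAB - nC1 * qAC) * (a₀ + D) + X₂) / g < (qAC * (a₀ + D) + X₃) / sC) :
    qAC ≠ 0 := by
  intro h0
  subst h0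
  have h := no_skipfree_coupling (qAB := qAB) (nC1 := nC1) hsC hg hD hX
    (by simpa using h12) (by simpa using h23) (by simpa using h12') (by simpa using h23')
  have hle : D * qAB * sC ≤ D * |qAB| * sC := by
    have := le_abs_self qAB
    have hD' := hD.le
    have hsC' := hsC.le
    nlinarith [mul_nonneg hD' hsC']
  linarith

/-- **Two-digit bookkeeping (the coupling must exceed the finer digit's curvature spread).**  Two digit levels `A ⊐ B`, `sB > 0`; the
last `B`-step of the run at coarse value `a` has slope `(q·a + Δlast)/sB`, the first `B`-step of the next run `(q·(a+1) + Δfirst)/sB`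
(`q` the coupling, `Δ` the unary increments of `B`).  If the carry slope lies strictly between them then `q > Δlast − Δfirst`: a digit that
multiplies needs a coupling to the next coarser digit larger than the spread of its own increments — in particular separable valuations
(`q = 0`) carry no second digit over a strictly convex run (`Δlast > Δfirst`). [folklore] -/
theorem coupling_gt_spread {sB q a Δlast Δfirst mcarry : ℝ} (hsB : 0 < sB)
    (h1 : (q * a + Δlast) / sB < mcarry) (h2 : mcarry < (q * (a + 1) + Δfirst) / sB) :
    Δlast - Δfirst < q := by
  have h := h1.trans h2
  rw [div_lt_div_iff_of_pos_right hsB] at h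
  linarith

end Summit.ValiantsHypothesis.ValiantsHypothesis.Theorems.KPlusLogSqLaw.OdometerAlignment
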